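import Summits.CriticalPhenomena.PercolationContinuityZ3.Theorems.Transplant.FKDoubleFanSesquiConeCrossA
import Summits.CriticalPhenomena.PercolationContinuityZ3.Theorems.Transplant.FKDoubleFanTwoSidedSignsB
import HarnessLib

/-!
# Double fans `K₂ ∨ P_{m+1}`: the EXACT LOCAL CRITERION for the dressed cone — `Hyp15A ∧ Hyp15B` ⟺ cross-positivity of `T_D` on the
# closure of the normalised dressed atoms; the far cross-apex theorem for all middles from that local condition alone

Helper file (`--supports stmt-CriticalPhenomena-4575`), FK sub-lane `prim-bschramm-fk-3` (gen 43); builds on p205010 (kernel theorem, internal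
audit signed; external expert review pending).  No named facts, no sorries; standard axioms.  Memo `bschramm/prim-bschramm-fk-3/FAR-CROSS-XVIII.md` §2.

`…SesquiCone` (gen 42): the far cross-apex theorem for every middle follows from `Hyp15A q ∧ Hyp15B q` — every rim step `∧²E_r`, `r ∈ [0,1]`,
maps every DRESSED generator `∧²AC_x·imgB q G w`, `∧²BC_y·imgA q F w` of `cone15 q` into `cone15 q`.  Since `∧²E_r` is the functional calculus
`diag(r², rμ, μ²)` (`μ = r + (1−r)q`) of the polarisation `T_D` (`…SesquiConeCrossA`), this closure statement — a family in the rim weight `r` —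
is EQUIVALENT to the `r`-free, first-order condition at `r = 1` (Schneider–Vidyasagar):
* **`CrossPosD15 q`**: for every `β` in **`atomClosure15 q`** (the closure in `ℝ¹⁰` of the normalised non-zero dressed atoms; compact; its
  half-space dual is exactly `DualS15 q`, **`dualS15_iff_atomClosure15`** — the undressed families are the cases `x = 0`, `y = 0`, `opAC_zero`,
  `opBC_zero`) and every `ρ ∈ DualS15 q` with `⟪β, ρ⟫ = 0`: `⟪T_D β, ρ⟫ ≥ 0`;
* **`dualS15_opE_of_crossPosD`**: under `CrossPosD15 q` (`0 < q < 1`) the dressed dual is stable under every `∧²E_r`, `r ∈ [0,1]` — `r > 0` by the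
  resolvent/exponential machinery (`pdualD_opE`; the positivity functional is `e₀` with `⟪β,e₀⟫ = ℓ(β)`, uniformly positive on the dressed atoms by
  the sign orthant of the single-fan images, **`norm_toFun_opBC_le_ellA`**, **`norm_toFun_opAC_le_ellA`**), `r = 0` by the rim-cut endpoints
  `hyp15A_rim_zero`, `hyp15B_rim_zero` (`…SesquiConeCut/CutA`);
* hence **`hyp15_of_crossPosD`**, the converse **`crossPosD_of_hyp15`** (first-order expansion of `⟪∧²E_r β, ρ⟫ ≥ 0` at `r = 1`),
  **`hyp15_iff_crossPosD`**, and **`negCorr_spokes_cross_far_of_crossPosD`**: `CrossPosD15 q` at `q ∈ (0,1)` ⟹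
  `φ(J_{ac_j} ∩ J_{bc_k}) ≤ φ(J_{ac_j})φ(J_{bc_k})` for every weighted double fan and all `j < k` (at `q = 1` the pairing vanishes identically,
  **`hyp15_one`**).
So the single remaining hypothesis of the depth-1½ route is a LOCAL tangency statement at the dressed generators: `T_D g ∈ cl(cone15 q + ℝg)` —
equivalently (as `T_D ∧²BC_y = ∧²BC_y T_D + y·C_y` with `∧²BC_y T_D a` a one-sided tangent direction) a statement about the COMMUTATOR term only.
Numerical status (memo §1): an LP cutting-plane test of `CrossPosD15` at ≈ 400 dressed generators (generic and boundary strata,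
`q ∈ {0.02,…,0.9}`) found no violation.  [folklore]
-/

noncomputable section

open Filter Topology

namespace Summit.CriticalPhenomena.PercolationContinuityZ3.Theorems

namespace FK

namespace ThreeApex

/-- `∧²AC_0 = id`. [folklore] -/
theorem opAC_zero (β : Biv) : opAC 0 β = β := by
  ext <;> simp [opAC, opTa, opWa, Biv.lin3, Biv.add, Biv.smul]

/-! ### The compact generating set of the dressed cone -/

/-- The normalised non-zero DRESSED atoms `∧²AC_x·imgB q G w`, `∧²BC_y·imgA q F w` (`G, F, w ∈ InS q`, `x, y ∈ [0,1]`) as coordinate vectors;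
the undressed single-fan images are the cases `x = 0`, `y = 0`. [folklore] -/
def atomSet15 (q : ℝ) : Set (Fin 10 → ℝ) :=
  {v | ∃ (G w : V5) (x : ℝ), InS q G ∧ InS q w ∧ 0 ≤ x ∧ x ≤ 1 ∧ Biv.toFun (opAC x (imgB q G w)) ≠ 0 ∧
      v = ‖Biv.toFun (opAC x (imgB q G w))‖⁻¹ • Biv.toFun (opAC x (imgB q G w))} ∪
  {v | ∃ (F w : V5) (y : ℝ), InS q F ∧ InS q w ∧ 0 ≤ y ∧ y ≤ 1 ∧ Biv.toFun (opBC y (imgA q F w)) ≠ 0 ∧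
      v = ‖Biv.toFun (opBC y (imgA q F w))‖⁻¹ • Biv.toFun (opBC y (imgA q F w))}

/-- **The compact generating set of `cone15`**: the closure of the normalised dressed atoms. [folklore] -/
def atomClosure15 (q : ℝ) : Set (Fin 10 → ℝ) := closure (atomSet15 q)

/-- Normalised atoms lie in the closed unit ball. [folklore] -/
theorem atomSet15_subset_closedBall (q : ℝ) : atomSet15 q ⊆ Metric.closedBall 0 1 := by
  rintro v (⟨G, w, x, -, -, -, -, hne, rfl⟩ | ⟨F, w, y, -, -, -, -, hne, rfl⟩) <;>
    rw [Metric.mem_closedBall, dist_zero_right, norm_smul, norm_inv, norm_norm, inv_mul_cancel₀ (norm_ne_zero_iff.2 hne)]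

/-- `atomClosure15 q` is compact. [folklore] -/
theorem isCompact_atomClosure15 (q : ℝ) : IsCompact (atomClosure15 q) :=
  (isCompact_closedBall (0 : Fin 10 → ℝ) 1).of_isClosed_subset isClosed_closure
    (closure_minimal (atomSet15_subset_closedBall q) Metric.isClosed_closedBall)

/-- A non-zero dressed atom: the input frame of `δ₀` (`y = 0`; `0 < q ≤ 1`). [folklore] -/
theorem atomSet15_nonempty {q : ℝ} (hq0 : 0 < q) (hq1 : q ≤ 1) : (atomSet15 q).Nonempty := by
  have hF : InS q fanInit := (fanInit_inKE q).inS hq0 hq1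
  have hw : InS q delta0 := (InKE.base (q := q)).inS hq0 hq1
  have hne : Biv.toFun (opBC 0 (imgA q fanInit delta0)) ≠ 0 := by
    intro h
    have h1 : Biv.toFun (opBC 0 (imgA q fanInit delta0)) 1 = 0 := by rw [h]; rfl
    rw [opBC_zero, imgA_fanInit] at h1
    simp [Biv.toFun, wedgeH, conv, edgeAC, delta0, hy, V5.total] at h1
  exact ⟨_, Or.inr ⟨fanInit, delta0, 0, hF, hw, le_rfl, zero_le_one, hne, rfl⟩⟩

/-- `atomClosure15 q` is nonempty (`0 < q ≤ 1`). [folklore] -/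
theorem atomClosure15_nonempty {q : ℝ} (hq0 : 0 < q) (hq1 : q ≤ 1) : (atomClosure15 q).Nonempty :=
  (atomSet15_nonempty hq0 hq1).mono subset_closure

/-- A closed half-space condition that holds on the dressed atoms holds on the closure. [folklore] -/
theorem atomClosure15_le_of_atoms {q : ℝ} {ρ : Biv} {c : ℝ}
    (hA : ∀ (G w : V5) (x : ℝ), InS q G → InS q w → 0 ≤ x → x ≤ 1 →
      c * ‖Biv.toFun (opAC x (imgB q G w))‖ ≤ pairH q (opAC x (imgB q G w)) ρ)
    (hB : ∀ (F w : V5) (y : ℝ), InS q F → InS q w → 0 ≤ y → y ≤ 1 →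
      c * ‖Biv.toFun (opBC y (imgA q F w))‖ ≤ pairH q (opBC y (imgA q F w)) ρ) :
    ∀ v ∈ atomClosure15 q, c ≤ pairH q (Biv.ofFun v) ρ := by
  have hcl : IsClosed {v : Fin 10 → ℝ | c ≤ pairH q (Biv.ofFun v) ρ} := isClosed_le continuous_const (continuous_pairH_ofFun q ρ)
  refine fun v hv => closure_minimal ?_ hcl hv
  rintro v (⟨G, w, x, hG, hw, hx0, hx1, hne, rfl⟩ | ⟨F, w, y, hF, hw, hy0, hy1, hne, rfl⟩)
  · have hn : 0 < ‖Biv.toFun (opAC x (imgB q G w))‖ := norm_pos_iff.2 hne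
    show c ≤ pairH q (Biv.ofFun (‖Biv.toFun (opAC x (imgB q G w))‖⁻¹ • Biv.toFun (opAC x (imgB q G w)))) ρ
    rw [Biv.ofFun_smul, pairH_smul_left, Biv.ofFun_toFun, le_inv_mul_iff₀ hn]
    simpa [mul_comm] using hA G w x hG hw hx0 hx1
  · have hn : 0 < ‖Biv.toFun (opBC y (imgA q F w))‖ := norm_pos_iff.2 hne
    show c ≤ pairH q (Biv.ofFun (‖Biv.toFun (opBC y (imgA q F w))‖⁻¹ • Biv.toFun (opBC y (imgA q F w)))) ρ
    rw [Biv.ofFun_smul, pairH_smul_left, Biv.ofFun_toFun, le_inv_mul_iff₀ hn]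
    simpa [mul_comm] using hB F w y hF hw hy0 hy1

/-- **The half-space dual of `atomClosure15 q` is `DualS15 q`.** [folklore] -/
theorem dualS15_iff_atomClosure15 (q : ℝ) (ρ : Biv) :
    DualS15 q ρ ↔ PDual q (atomClosure15 q) (fun v => Biv.ofFun v) ρ := by
  constructor
  · intro hρ v hv
    have := atomClosure15_le_of_atoms (q := q) (ρ := ρ) (c := 0)
      (fun G w x hG hw hx0 hx1 => by simpa using hρ.2.1 G w x hG hw hx0 hx1)
      (fun F w y hF hw hy0 hy1 => by simpa using hρ.2.2 F w y hF hw hy0 hy1) v hv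
    simpa using this
  · intro h
    have hA : ∀ (G w : V5) (x : ℝ), InS q G → InS q w → 0 ≤ x → x ≤ 1 → 0 ≤ pairH q (opAC x (imgB q G w)) ρ := by
      intro G w x hG hw hx0 hx1
      by_cases hne : Biv.toFun (opAC x (imgB q G w)) = 0
      · have e : opAC x (imgB q G w) = Biv.ofFun 0 := by rw [← hne, Biv.ofFun_toFun]
        rw [e, pairH_ofFun_zero]
      · have hn : 0 < ‖Biv.toFun (opAC x (imgB q G w))‖ := norm_pos_iff.2 hne
        have hv : ‖Biv.toFun (opAC x (imgB q G w))‖⁻¹ • Biv.toFun (opAC x (imgB q G w)) ∈ atomClosure15 q :=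
          subset_closure (Or.inl ⟨G, w, x, hG, hw, hx0, hx1, hne, rfl⟩)
        have := h _ hv
        dsimp only at this
        rw [Biv.ofFun_smul, pairH_smul_left, Biv.ofFun_toFun] at this
        exact (mul_nonneg_iff_of_pos_left (inv_pos.2 hn)).1 this
    have hB : ∀ (F w : V5) (y : ℝ), InS q F → InS q w → 0 ≤ y → y ≤ 1 → 0 ≤ pairH q (opBC y (imgA q F w)) ρ := by
      intro F w y hF hw hy0 hy1
      by_cases hne : Biv.toFun (opBC y (imgA q F w)) = 0
      · have e : opBC y (imgA q F w) = Biv.ofFun 0 := by rw [← hne, Biv.ofFun_toFun]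
        rw [e, pairH_ofFun_zero]
      · have hn : 0 < ‖Biv.toFun (opBC y (imgA q F w))‖ := norm_pos_iff.2 hne
        have hv : ‖Biv.toFun (opBC y (imgA q F w))‖⁻¹ • Biv.toFun (opBC y (imgA q F w)) ∈ atomClosure15 q :=
          subset_closure (Or.inr ⟨F, w, y, hF, hw, hy0, hy1, hne, rfl⟩)
        have := h _ hv
        dsimp only at this
        rw [Biv.ofFun_smul, pairH_smul_left, Biv.ofFun_toFun] at this
        exact (mul_nonneg_iff_of_pos_left (inv_pos.2 hn)).1 this
    refine ⟨⟨fun F w hF hw => ?_, fun G w hG hw => ?_⟩, hA, hB⟩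
    · rw [← opBC_zero (imgA q F w)]; exact hB F w 0 hF hw le_rfl zero_le_one
    · rw [← opAC_zero (imgB q G w)]; exact hA G w 0 hG hw le_rfl zero_le_one

/-- Points of the closure lie in the (closed) cone `cone15 q`. [folklore] -/
theorem ofFun_mem_cone15_of_mem_atomClosure15 {q : ℝ} {v : Fin 10 → ℝ} (hv : v ∈ atomClosure15 q) : Biv.ofFun v ∈ cone15 q :=
  fun γ hγ => (dualS15_iff_atomClosure15 q γ).1 hγ v hv

/-! ### The positivity functional on the dressed atoms -/

/-- `∧²BC_y` in closed form: weights `(1−y)², (1−y), 1` on the three `T_b`-classes. [folklore] -/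
theorem opBC_explicit (y : ℝ) (β : Biv) :
    opBC y β = ⟨(1 - y) ^ 2 * β.ux, (1 - y) ^ 2 * β.uy, (1 - y) * β.uz, (1 - y) * β.uv, (1 - y) ^ 2 * β.xy, (1 - y) * β.xz,
      (1 - y) * β.xv, (1 - y) * β.yz, (1 - y) * β.yv, β.zv⟩ := by
  ext <;> simp [opBC, opTb, opWb, Biv.lin3, Biv.add, Biv.smul] <;> ring

/-- `∧²AC_x` in closed form: weights `(1−x)², (1−x), 1` on the three `T_a`-classes. [folklore] -/
theorem opAC_explicit (x : ℝ) (β : Biv) :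
    opAC x β = ⟨(1 - x) ^ 2 * β.ux, (1 - x) * β.uy, (1 - x) ^ 2 * β.uz, (1 - x) * β.uv, (1 - x) * β.xy, (1 - x) ^ 2 * β.xz,
      (1 - x) * β.xv, (1 - x) * β.yz, β.yv, (1 - x) * β.zv⟩ := by
  ext <;> simp [opAC, opTa, opWa, Biv.lin3, Biv.add, Biv.smul] <;> ring

/-- The coordinates of a bivector are bounded by the sup norm of its coordinate vector. [folklore] -/
theorem Biv.abs_le_of_norm_toFun_le {β : Biv} {L : ℝ} (hn : ‖Biv.toFun β‖ ≤ L) :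
    |β.ux| ≤ L ∧ |β.uy| ≤ L ∧ |β.uz| ≤ L ∧ |β.uv| ≤ L ∧ |β.xy| ≤ L ∧ |β.xz| ≤ L ∧ |β.xv| ≤ L ∧ |β.yz| ≤ L ∧ |β.yv| ≤ L ∧ |β.zv| ≤ L := by
  refine ⟨?_, ?_, ?_, ?_, ?_, ?_, ?_, ?_, ?_, ?_⟩
  · simpa [Biv.toFun] using (norm_le_pi_norm (Biv.toFun β) 0).trans hn
  · simpa [Biv.toFun] using (norm_le_pi_norm (Biv.toFun β) 1).trans hn
  · simpa [Biv.toFun] using (norm_le_pi_norm (Biv.toFun β) 2).trans hn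
  · simpa [Biv.toFun] using (norm_le_pi_norm (Biv.toFun β) 3).trans hn
  · simpa [Biv.toFun] using (norm_le_pi_norm (Biv.toFun β) 4).trans hn
  · simpa [Biv.toFun] using (norm_le_pi_norm (Biv.toFun β) 5).trans hn
  · simpa [Biv.toFun] using (norm_le_pi_norm (Biv.toFun β) 6).trans hn
  · simpa [Biv.toFun] using (norm_le_pi_norm (Biv.toFun β) 7).trans hn
  · simpa [Biv.toFun] using (norm_le_pi_norm (Biv.toFun β) 8).trans hn
  · simpa [Biv.toFun] using (norm_le_pi_norm (Biv.toFun β) 9).trans hn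

/-- Scaling a bound: `|a^k·t| ≤ a^k·L ≤ R` for `0 ≤ a^k`, `|t| ≤ L`, `a^k·L ≤ R`. [folklore] -/
theorem abs_mul_le_of_le {a t L R : ℝ} (ha : 0 ≤ a) (ht : |t| ≤ L) (hR : a * L ≤ R) : |a * t| ≤ R := by
  rw [abs_mul, abs_of_nonneg ha]; exact (mul_le_mul_of_nonneg_left ht ha).trans hR

/-- A `b`-spoke keeps the sup norm dominated by `ℓ`: if `‖β‖∞ ≤ ℓ(β)` and `β_uv, β_xv, β_yv, β_zv ≥ 0`, then `‖∧²BC_y β‖∞ ≤ ℓ(∧²BC_y β)` for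
`y ∈ [0,1]`. [folklore] -/
theorem norm_toFun_opBC_le_ellA {β : Biv} {y : ℝ} (hy0 : 0 ≤ y) (hy1 : y ≤ 1) (hn : ‖Biv.toFun β‖ ≤ ellA β) (huv : 0 ≤ β.uv)
    (hxv : 0 ≤ β.xv) (hyv : 0 ≤ β.yv) (hzv : 0 ≤ β.zv) : ‖Biv.toFun (opBC y β)‖ ≤ ellA (opBC y β) := by
  obtain ⟨c0, c1, c2, c3, c4, c5, c6, c7, c8, c9⟩ := Biv.abs_le_of_norm_toFun_le hn
  set L := ellA β with hL
  set R := (1 - y) * (β.uv + β.xv + β.yv) + β.zv with hR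
  have e : ellA (opBC y β) = R := by rw [hR, opBC_explicit]; simp only [ellA]; ring
  have h1 : 0 ≤ 1 - y := sub_nonneg.2 hy1
  have h2 : 0 ≤ (1 - y) ^ 2 := sq_nonneg _
  have hLe : L = β.uv + β.xv + β.yv + β.zv := by rw [hL, ellA]
  have hR1 : (1 - y) * L ≤ R := by rw [hLe, hR]; nlinarith
  have hR2 : (1 - y) ^ 2 * L ≤ R := by
    have : (1 - y) ^ 2 * L ≤ (1 - y) * L := by
      have hL0 : 0 ≤ L := by rw [hLe]; linarith
      have hsq : (1 - y) ^ 2 ≤ 1 - y := by nlinarith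
      exact mul_le_mul_of_nonneg_right hsq hL0
    exact this.trans hR1
  have hR0 : 0 ≤ R := by rw [hR]; positivity
  have hz : |β.zv| ≤ R := by rw [abs_of_nonneg hzv, hR]; nlinarith
  rw [e, opBC_explicit]
  exact Biv.norm_toFun_le _ hR0 (abs_mul_le_of_le h2 c0 hR2) (abs_mul_le_of_le h2 c1 hR2) (abs_mul_le_of_le h1 c2 hR1)
    (abs_mul_le_of_le h1 c3 hR1) (abs_mul_le_of_le h2 c4 hR2) (abs_mul_le_of_le h1 c5 hR1) (abs_mul_le_of_le h1 c6 hR1)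
    (abs_mul_le_of_le h1 c7 hR1) (abs_mul_le_of_le h1 c8 hR1) hz

/-- An `a`-spoke keeps the sup norm dominated by `ℓ` (mirror of `norm_toFun_opBC_le_ellA`). [folklore] -/
theorem norm_toFun_opAC_le_ellA {β : Biv} {x : ℝ} (hx0 : 0 ≤ x) (hx1 : x ≤ 1) (hn : ‖Biv.toFun β‖ ≤ ellA β) (huv : 0 ≤ β.uv)
    (hxv : 0 ≤ β.xv) (hyv : 0 ≤ β.yv) (hzv : 0 ≤ β.zv) : ‖Biv.toFun (opAC x β)‖ ≤ ellA (opAC x β) := by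
  obtain ⟨c0, c1, c2, c3, c4, c5, c6, c7, c8, c9⟩ := Biv.abs_le_of_norm_toFun_le hn
  set L := ellA β with hL
  set R := (1 - x) * (β.uv + β.xv + β.zv) + β.yv with hR
  have e : ellA (opAC x β) = R := by rw [hR, opAC_explicit]; simp only [ellA]; ring
  have h1 : 0 ≤ 1 - x := sub_nonneg.2 hx1
  have h2 : 0 ≤ (1 - x) ^ 2 := sq_nonneg _
  have hLe : L = β.uv + β.xv + β.yv + β.zv := by rw [hL, ellA]
  have hR1 : (1 - x) * L ≤ R := by rw [hLe, hR]; nlinarith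
  have hR2 : (1 - x) ^ 2 * L ≤ R := by
    have : (1 - x) ^ 2 * L ≤ (1 - x) * L := by
      have hL0 : 0 ≤ L := by rw [hLe]; linarith
      have hsq : (1 - x) ^ 2 ≤ 1 - x := by nlinarith
      exact mul_le_mul_of_nonneg_right hsq hL0
    exact this.trans hR1
  have hR0 : 0 ≤ R := by rw [hR]; positivity
  have hy : |β.yv| ≤ R := by rw [abs_of_nonneg hyv, hR]; nlinarith
  rw [e, opAC_explicit]
  exact Biv.norm_toFun_le _ hR0 (abs_mul_le_of_le h2 c0 hR2) (abs_mul_le_of_le h1 c1 hR1) (abs_mul_le_of_le h2 c2 hR2)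
    (abs_mul_le_of_le h1 c3 hR1) (abs_mul_le_of_le h1 c4 hR1) (abs_mul_le_of_le h2 c5 hR2) (abs_mul_le_of_le h1 c6 hR1)
    (abs_mul_le_of_le h1 c7 hR1) hy (abs_mul_le_of_le h1 c9 hR1)

/-- `e₀` is uniformly positive on the `a`-dressed `b`-images (`c = 1`; `0 ≤ q < 1`). [folklore] -/
theorem hpos15A_e0Biv {q : ℝ} (hq0 : 0 ≤ q) (hq1 : q < 1) :
    ∀ (G w : V5) (x : ℝ), InS q G → InS q w → 0 ≤ x → x ≤ 1 →
      1 * ‖Biv.toFun (opAC x (imgB q G w))‖ ≤ pairH q (opAC x (imgB q G w)) (e0Biv q) := fun G w x hG hw hx0 hx1 => by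
  rw [one_mul, pairH_e0Biv hq1]
  exact norm_toFun_opAC_le_ellA hx0 hx1 (norm_toFun_imgB_le_ellA hq0 hq1.le hG.valid hw.valid) (imgB_uv_nonneg hq0 hq1.le hG.valid hw.valid)
    (imgB_xv_nonneg hq0 hq1.le hG.valid hw.valid) (imgB_yv_nonneg hq0 hq1.le hG.valid hw.valid) (imgB_zv_nonneg hq0 hq1.le hG.valid hw.valid)

/-- `e₀` is uniformly positive on the `b`-dressed `a`-images (`c = 1`; `0 ≤ q < 1`). [folklore] -/
theorem hpos15B_e0Biv {q : ℝ} (hq0 : 0 ≤ q) (hq1 : q < 1) :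
    ∀ (F w : V5) (y : ℝ), InS q F → InS q w → 0 ≤ y → y ≤ 1 →
      1 * ‖Biv.toFun (opBC y (imgA q F w))‖ ≤ pairH q (opBC y (imgA q F w)) (e0Biv q) := fun F w y hF hw hy0 hy1 => by
  rw [one_mul, pairH_e0Biv hq1]
  exact norm_toFun_opBC_le_ellA hy0 hy1 (norm_toFun_imgA_le_ellA hq0 hq1.le hF.valid hw.valid) (imgA_uv_nonneg hq0 hq1.le hF.valid hw.valid)
    (imgA_xv_nonneg hq0 hq1.le hF.valid hw.valid) (imgA_yv_nonneg hq0 hq1.le hF.valid hw.valid) (imgA_zv_nonneg hq0 hq1.le hF.valid hw.valid)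

/-! ### The exact local criterion -/

/-- **`CrossPosD15 q`** — CROSS-POSITIVITY OF `T_D` ON THE DRESSED CONE: for every `β` in the closure of the normalised dressed atoms and every
`ρ ∈ DualS15 q` with `⟪β, ρ⟫ = 0`, `⟪T_D β, ρ⟫ ≥ 0` (i.e. `T_D β` lies in the tangent cone `cl(cone15 q + ℝβ)`). [folklore] -/
def CrossPosD15 (q : ℝ) : Prop :=
  ∀ v ∈ atomClosure15 q, ∀ ρ : Biv, DualS15 q ρ → pairH q (Biv.ofFun v) ρ = 0 → 0 ≤ pairH q (opTD q (Biv.ofFun v)) ρ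

/-- The dressed dual is stable under the rim CUT `∧²E_0 = W_D` (unconditionally, by the rim-cut endpoints of `…SesquiConeCut/CutA`; `0 < q ≤ 1`).
[folklore] -/
theorem DualS15.rim_zero {q : ℝ} (hq0 : 0 < q) (hq1 : q ≤ 1) {ρ : Biv} (hρ : DualS15 q ρ) : DualS15 q (opE q 0 ρ) := by
  refine ⟨⟨fun F w hF hw => ?_, fun G w hG hw => ?_⟩, fun G w x hG hw hx0 hx1 => ?_, fun F w y hF hw hy0 hy1 => ?_⟩
  · rw [← pairH_opE, opE_imgA]; exact hρ.1.1 _ w (hF.rimStep hq0 hq1 le_rfl zero_le_one) hw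
  · rw [← pairH_opE, opE_imgB]; exact hρ.1.2 _ w (hG.rimStep hq0 hq1 le_rfl zero_le_one) hw
  · rw [← pairH_opE]; exact hyp15A_rim_zero hq0 hq1 hG hw hx0 hx1 ρ hρ
  · rw [← pairH_opE]; exact hyp15B_rim_zero hq0 hq1 hF hw hy0 hy1 ρ hρ

/-- **Rim-step stability of the dressed dual from cross-positivity** (`0 < q < 1`, `r ∈ [0,1]`). [folklore] -/
theorem dualS15_opE_of_crossPosD {q : ℝ} (hq0 : 0 < q) (hq1 : q < 1) (hcross : CrossPosD15 q) {ρ : Biv} (hρ : DualS15 q ρ)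
    {r : ℝ} (hr0 : 0 ≤ r) (hr1 : r ≤ 1) : DualS15 q (opE q r ρ) := by
  rcases hr0.eq_or_lt with rfl | hr0'
  · exact hρ.rim_zero hq0 hq1.le
  set P := atomClosure15 q
  set α : (Fin 10 → ℝ) → Biv := fun v => Biv.ofFun v
  have hPc : IsCompact P := isCompact_atomClosure15 q
  have hPn : P.Nonempty := atomClosure15_nonempty hq0 hq1.le
  have hec : ∀ v ∈ P, 1 ≤ pairH q (α v) (e0Biv q) :=
    atomClosure15_le_of_atoms (hpos15A_e0Biv hq0.le hq1) (hpos15B_e0Biv hq0.le hq1)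
  have he : ∀ v ∈ P, 0 < pairH q (α v) (e0Biv q) := fun v hv => lt_of_lt_of_le one_pos (hec v hv)
  have hcont : ∀ ρ : Biv, ContinuousOn (fun v => pairH q (α v) ρ) P := fun ρ => (continuous_pairH_ofFun q ρ).continuousOn
  have hcontq : ∀ ρ : Biv, ContinuousOn (fun v => pairH q (α v) ρ / pairH q (α v) (e0Biv q)) P :=
    fun ρ => (hcont ρ).div (hcont (e0Biv q)) fun v hv => (he v hv).ne'
  obtain ⟨vM, hvM, hmax⟩ := hPc.exists_isMaxOn hPn (hcontq (opTD q (e0Biv q)))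
  set M : ℝ := max (pairH q (α vM) (opTD q (e0Biv q)) / pairH q (α vM) (e0Biv q)) 1 with hMdef
  have hM0 : 0 < M := lt_of_lt_of_le zero_lt_one (le_max_right _ _)
  have hM : ∀ v ∈ P, pairH q (α v) (opTD q (e0Biv q)) ≤ M * pairH q (α v) (e0Biv q) :=
    fun v hv => (div_le_iff₀ (he v hv)).1 (le_trans (hmax hv) (le_max_left _ _))
  have hmin : ∀ ρ : Biv, (∃ x ∈ P, pairH q (α x) ρ < 0) →
      ∃ x₀ ∈ P, ∀ x ∈ P, pairH q (α x₀) ρ * pairH q (α x) (e0Biv q) ≤ pairH q (α x) ρ * pairH q (α x₀) (e0Biv q) := by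
    intro ρ _
    obtain ⟨x₀, hx₀, hmin⟩ := hPc.exists_isMinOn hPn (hcontq ρ)
    exact ⟨x₀, hx₀, fun x hx => (div_le_div_iff₀ (he x₀ hx₀) (he x hx)).1 (hmin hx)⟩
  have hcross' : ∀ x ∈ P, ∀ ρ : Biv, PDual q P α ρ → pairH q (α x) ρ = 0 → 0 ≤ pairH q (opTD q (α x)) ρ :=
    fun x hx ρ hρ h0 => hcross x hx ρ ((dualS15_iff_atomClosure15 q ρ).2 hρ) h0
  exact (dualS15_iff_atomClosure15 q _).2
    (pdualD_opE hq0 he hM hmin hcross' hM0 hr0' hr1 ((dualS15_iff_atomClosure15 q ρ).1 hρ))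

/-- **`Hyp15A ∧ Hyp15B` FROM CROSS-POSITIVITY OF `T_D`** (`0 < q < 1`). [folklore] -/
theorem hyp15_of_crossPosD {q : ℝ} (hq0 : 0 < q) (hq1 : q < 1) (hcross : CrossPosD15 q) : Hyp15A q ∧ Hyp15B q := by
  refine ⟨fun G w x r hG hw hx0 hx1 hr0 hr1 γ hγ => ?_, fun F w y r hF hw hy0 hy1 hr0 hr1 γ hγ => ?_⟩
  · rw [pairH_opE]; exact (dualS15_opE_of_crossPosD hq0 hq1 hcross hγ hr0 hr1).2.1 G w x hG hw hx0 hx1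
  · rw [pairH_opE]; exact (dualS15_opE_of_crossPosD hq0 hq1 hcross hγ hr0 hr1).2.2 F w y hF hw hy0 hy1

/-- `⟪∧²E_r β, γ⟫` as a quadratic polynomial in `r`. [folklore] -/
theorem pairH_opE_poly (q r : ℝ) (β γ : Biv) :
    pairH q (opE q r β) γ = r ^ 2 * pairH q β γ + r * (1 - r) * pairH q (opTD q β) γ + (1 - r) ^ 2 * pairH q (opWD q β) γ := by
  rw [opE, pairH_lin3_left]

/-- Under `Hyp15A ∧ Hyp15B`, every rim step maps the closure of the normalised dressed atoms into `cone15 q`. [folklore] -/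
theorem opE_ofFun_mem_cone15_of_hyp15 {q : ℝ} (hA : Hyp15A q) (hB : Hyp15B q) {r : ℝ} (hr0 : 0 ≤ r) (hr1 : r ≤ 1) :
    ∀ v ∈ atomClosure15 q, opE q r (Biv.ofFun v) ∈ cone15 q := by
  intro v hv γ hγ
  have hcl : IsClosed {v : Fin 10 → ℝ | 0 ≤ pairH q (opE q r (Biv.ofFun v)) γ} := by
    have : Continuous fun v : Fin 10 → ℝ => pairH q (opE q r (Biv.ofFun v)) γ := by
      simp only [pairH_opE]; exact continuous_pairH_ofFun q _
    exact isClosed_le continuous_const this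
  refine closure_minimal ?_ hcl hv
  rintro v (⟨G, w, x, hG, hw, hx0, hx1, hne, rfl⟩ | ⟨F, w, y, hF, hw, hy0, hy1, hne, rfl⟩)
  · show 0 ≤ pairH q (opE q r (Biv.ofFun (‖Biv.toFun (opAC x (imgB q G w))‖⁻¹ • Biv.toFun (opAC x (imgB q G w))))) γ
    rw [Biv.ofFun_smul, Biv.ofFun_toFun, pairH_opE, pairH_smul_left, ← pairH_opE]
    exact mul_nonneg (inv_nonneg.2 (norm_nonneg _)) (hA G w x r hG hw hx0 hx1 hr0 hr1 γ hγ)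
  · show 0 ≤ pairH q (opE q r (Biv.ofFun (‖Biv.toFun (opBC y (imgA q F w))‖⁻¹ • Biv.toFun (opBC y (imgA q F w))))) γ
    rw [Biv.ofFun_smul, Biv.ofFun_toFun, pairH_opE, pairH_smul_left, ← pairH_opE]
    exact mul_nonneg (inv_nonneg.2 (norm_nonneg _)) (hB F w y r hF hw hy0 hy1 hr0 hr1 γ hγ)

/-- **The criterion is exact**: `Hyp15A ∧ Hyp15B` implies cross-positivity of `T_D` (first-order expansion of `⟪∧²E_r β, ρ⟫ ≥ 0` at `r = 1`).
[folklore] -/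
theorem crossPosD_of_hyp15 {q : ℝ} (hA : Hyp15A q) (hB : Hyp15B q) : CrossPosD15 q := by
  intro v hv ρ hρ h0
  set β := Biv.ofFun v with hβ
  have hg : ∀ r : ℝ, 0 ≤ r → r ≤ 1 → 0 ≤ r * (1 - r) * pairH q (opTD q β) ρ + (1 - r) ^ 2 * pairH q (opWD q β) ρ := by
    intro r hr0 hr1
    have := opE_ofFun_mem_cone15_of_hyp15 hA hB hr0 hr1 v hv ρ hρ
    rwa [pairH_opE_poly, h0, mul_zero, zero_add] at this
  by_contra hT; rw [not_le] at hT
  set T := pairH q (opTD q β) ρ with hTdef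
  set W := pairH q (opWD q β) ρ with hWdef
  by_cases hW : W ≤ 0
  · have := hg (1 / 2) (by norm_num) (by norm_num)
    nlinarith
  · rw [not_le] at hW
    have hWT : 0 < W - T := by linarith
    -- with y := 1 − r the condition reads y(1−y)T + y²W ≥ 0; choose y = −T/(2(W−T)) ∈ (0, 1/2]
    set y : ℝ := -T / (2 * (W - T)) with hy
    have hy0 : 0 < y := by rw [hy]; exact div_pos (by linarith) (by linarith)
    have hy1 : y ≤ 1 / 2 := by rw [hy, div_le_iff₀ (by linarith)]; linarith
    have := hg (1 - y) (by linarith) (by linarith)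
    have e : (1 - y) * (1 - (1 - y)) * T + (1 - (1 - y)) ^ 2 * W = y * (T + y * (W - T)) := by ring
    have e2 : y * (W - T) = -T / 2 := by rw [hy]; field_simp
    rw [e, e2] at this
    nlinarith

/-- **`Hyp15A ∧ Hyp15B` ⟺ cross-positivity of `T_D` on the dressed cone** (`0 < q < 1`). [folklore] -/
theorem hyp15_iff_crossPosD {q : ℝ} (hq0 : 0 < q) (hq1 : q < 1) : (Hyp15A q ∧ Hyp15B q) ↔ CrossPosD15 q :=
  ⟨fun h => crossPosD_of_hyp15 h.1 h.2, hyp15_of_crossPosD hq0 hq1⟩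

/-- At `q = 1` the pairing vanishes identically, so `Hyp15A 1 ∧ Hyp15B 1` holds trivially. [folklore] -/
theorem hyp15_one : Hyp15A 1 ∧ Hyp15B 1 := by
  refine ⟨fun G w x r _ _ _ _ _ _ γ _ => ?_, fun F w y r _ _ _ _ _ _ γ _ => ?_⟩ <;> simp [pairH]

open MeasureTheory Literature.Probability.LatticeModels Literature.Probability.Percolation
open scoped Classical

variable {V : Type*} [Fintype V]

section Setting

variable {a b : V} {c : ℕ → V} {m : ℕ}
variable (hab : a ≠ b) (hinj : ∀ j k, j ≤ m → k ≤ m → c j = c k → j = k) (hca : ∀ j, j ≤ m → c j ≠ a) (hcb : ∀ j, j ≤ m → c j ≠ b)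
include hab hinj hca hcb

/-- **NEGATIVE CORRELATION OF EVERY CROSS-APEX PAIR AT EVERY DISTANCE FROM CROSS-POSITIVITY OF `T_D` ON THE DRESSED CONE.**  If, at
`q ∈ (0,1)`, `⟪T_D β, ρ⟫ ≥ 0` for every `β` in the closure of the normalised dressed atoms and every `ρ ∈ DualS15 q` with `⟪β, ρ⟫ = 0`
(`CrossPosD15 q`; vacuous at `q = 1`), then for every weighted double fan (`card V = m + 3`, weights supported on the double-fan pairs) and all
`j < k ≤ m`: `φ(J_{a c_j} ∩ J_{b c_k}) ≤ φ(J_{a c_j})·φ(J_{b c_k})`. [folklore] -/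
theorem negCorr_spokes_cross_far_of_crossPosD (hcard : Fintype.card V = m + 3) {q : ℝ} (hq0 : 0 < q) (hq1 : q ≤ 1)
    (w : Sym2 V → unitInterval) (hsupp : ∀ e, e ∉ dfPairs a b c m → w e = 0) (hcross : q < 1 → CrossPosD15 q)
    {j k : ℕ} (hjk : j < k) (hk : k ≤ m) :
    (rcMeasureW w q ∅).real ({ω : BondConfig V | s(a, c j) ∈ ω} ∩ {ω | s(b, c k) ∈ ω}) ≤
      (rcMeasureW w q ∅).real {ω : BondConfig V | s(a, c j) ∈ ω} * (rcMeasureW w q ∅).real {ω : BondConfig V | s(b, c k) ∈ ω} := by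
  rcases eq_or_lt_of_le hq1 with h1 | h1
  · subst h1
    exact negCorr_spokes_cross_far_of_hyp15 hab hinj hca hcb hcard one_pos le_rfl w hsupp hyp15_one.1 hyp15_one.2 hjk hk
  · have h := hyp15_of_crossPosD hq0 h1 (hcross h1)
    exact negCorr_spokes_cross_far_of_hyp15 hab hinj hca hcb hcard hq0 hq1 w hsupp h.1 h.2 hjk hk

end Setting

end ThreeApex

end FK

end Summit.CriticalPhenomena.PercolationContinuityZ3.Theorems
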